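import Summits.BirchSwinnertonDyer.BirchSwinnertonDyer.Theorems.SignedLowerHalvesSprungLowerHalfAtThreeSplit
import Summits.BirchSwinnertonDyer.BirchSwinnertonDyer.Theorems.SignedLowerHalvesSprungLowerHalfAtThreeSplitInputs
import Summits.BirchSwinnertonDyer.BirchSwinnertonDyer.Theorems.SignedLowerHalvesSprungLowerHalfAtThreeSplitConverse
import HarnessLib

/-!
# Route `SignedLowerHalves`, crux 5 `SprungLowerHalfAtThree` BY NAME from its ONE open child K1
# (MC↓•) plus held print — compositions of the split's glue (p482444), the S4 edges (p482847) and the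
# K2 ⟸ K1 reduction (`…SplitConverse.lean`)
# (cell `bsd-ssimc`, seat `bsd-ssimc-k3c5-kdot-split` g4; `--supports … --as helper`, closes nothing)

PARTITION (cell bsd-ssimc): X8 (A8) — `p = 3` good supersingular, `a_3 = ±3` — all conductors;
proves-the-glue-of (crux 5 ⟸ K1 ∧ K3 ∧ S4 ∧ Lemma 5.6); closes NONE; 0 census moves; BSD is not
proved by any of this.

## What this file proves

* `sharpFlatRankZeroConverseAtThree_of_sprungLowerDivisibility_of_namedFacts` — K2 ⟸ K1 with S4
  replaced by its three print sources (`exists_isNewformOf`, `Sprung2012.thm22_exists_isHondaSystem`,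
  `Sprung2012.thm714_sharpFlatSelmerDual_finite_torsion`) through `sharpFlatPublishedInputsAtThree_of_namedFacts`;
* `sprungLowerHalfAtThree_of_sprungLowerDivisibility` — **crux 5 from K1 ALONE plus held print**:
  `lem56AllN → K3 → S4 → K1 → SprungLowerHalfAtThree` = the glue `sprungLowerHalfAtThreeGlue_holds`
  with K2 discharged by `sharpFlatRankZeroConverseAtThree_of_sprungLowerDivisibility` (the shape a
  planner re-glue «K1 ∧ K3 ∧ S4 ∧ K5, K5 := Sprung2024.lem56AllN_… by name» would consume with one
  `exact`);
* `sprungLowerHalfAtThree_of_sprungLowerDivisibility_of_namedFacts` — the same from K1 and the five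
  named facts (`lem56AllN`, `lem59AllN`, `exists_isNewformOf`, `thm22`, `thm714`).

HONEST STATUS: CONDITIONAL on K1 (OPEN conjecture) and the named facts; closes nothing; 0 cells
move. This module deliberately sits in the route's cone (it composes by-name glue theorems).

References: [Sprung2024] §5.2 Lemmas 5.5–5.9 (pp. 40–41); [Sprung2012] Thm. 2.2, Thm. 7.14, Main
Conj. 7.21; [RaySprung2025] p. 2343; [BCDTJAMS2001] Thm. A; [GreenbergLNM1716] Lemma 4.2.
-/

set_option autoImplicit false
-- justification: the mandated namespace `Summit.BirchSwinnertonDyer.BirchSwinnertonDyer.Theorems`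
-- (single-conjunct summit, Sub = Summit) repeats a segment by design (D-0017).
set_option linter.dupNamespace false

noncomputable section

namespace Summit.BirchSwinnertonDyer.BirchSwinnertonDyer.Theorems.SprungLowerHalfAtThreeSplit

open Literature.NumberTheory.EllipticCurves Literature.NumberTheory.EllipticCurves.ModularForms
  Literature.NumberTheory.EllipticCurves.Sprung2012 Literature.NumberTheory.EllipticCurves.Sprung2024
  Summit.BirchSwinnertonDyer.BirchSwinnertonDyer.Theses.SignedLowerHalves

/-- **(conv₀) ⟸ (MC↓•) on X8 from the NAMED PRINT SOURCES of S4** — modularity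
(`exists_isNewformOf`), Sprung 2012 Thm. 2.2 (`thm22_exists_isHondaSystem`) and Thm. 1.2/7.14
(`thm714_sharpFlatSelmerDual_finite_torsion`) — through the edge
`sharpFlatPublishedInputsAtThree_of_namedFacts` (p482847). CONDITIONAL on K1 (OPEN) and the four
named facts; closes nothing. [cite: Sprung2024, §5.2 Lemma 5.6 (p. 41)]
[cite: Sprung2012, Thm. 2.2, Thm. 1.2 and Main Conj. 7.21] [cite: BCDTJAMS2001, Thm. A] -/
theorem sharpFlatRankZeroConverseAtThree_of_sprungLowerDivisibility_of_namedFacts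
    (hctrl : lem56AllN_sharpFlat_finite_coinvariants_of_finite_selmer)
    (hmod : exists_isNewformOf) (h22 : Sprung2012.thm22_exists_isHondaSystem)
    (h714 : Sprung2012.thm714_sharpFlatSelmerDual_finite_torsion)
    (hK1 : SprungLowerDivisibilityAtThree) : SharpFlatRankZeroConverseAtThree :=
  sharpFlatRankZeroConverseAtThree_of_sprungLowerDivisibility hctrl
    (sharpFlatPublishedInputsAtThree_of_namedFacts hmod h22 h714) hK1

/-! ### Crux 5 BY NAME from K1 alone (plus held print) -/

/-- **Crux 5 `SprungLowerHalfAtThree` from its ONE open child K1 (MC↓•) and held print** — the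
glue `sprungLowerHalfAtThreeGlue_holds` (p482444) with K2 discharged by
`sharpFlatRankZeroConverseAtThree_of_sprungLowerDivisibility`: `lem56AllN → K3 → S4 → K1 → crux 5`.
CONDITIONAL on K1 (OPEN conjecture), K3 (`Sprung2024.lem59AllN_…`, held), S4 (modularity, Sprung
2012 Thm. 2.2 / 7.14, held) and Lemma 5.6 (held, allN flag); closes nothing; 0 cells move.
[cite: Sprung2024, §5.2 Lemmas 5.5–5.9 (pp. 40–41)] [cite: Sprung2012, Thm. 2.2, Thm. 7.14 and Main Conj. 7.21]
[cite: BCDTJAMS2001, Thm. A] -/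
theorem sprungLowerHalfAtThree_of_sprungLowerDivisibility
    (hctrl : lem56AllN_sharpFlat_finite_coinvariants_of_finite_selmer)
    (hK3 : SharpFlatCharValueRankZeroAllLevels) (hS4 : SharpFlatPublishedInputsAtThree)
    (hK1 : SprungLowerDivisibilityAtThree) : SprungLowerHalfAtThree :=
  sprungLowerHalfAtThreeGlue_holds hK1
    (sharpFlatRankZeroConverseAtThree_of_sprungLowerDivisibility hctrl hS4 hK1) hK3 hS4

/-- **Crux 5 from K1 and NAMED PRINT only**: `lem56AllN → lem59AllN → exists_isNewformOf → thm22 →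
thm714 → K1 → SprungLowerHalfAtThree` (K3 unfolds to `Sprung2024.lem59AllN_…`; S4 from its sources
by p482847). CONDITIONAL on K1 (OPEN) and the five named facts; closes nothing.
[cite: Sprung2024, §5.2 Lemmas 5.5–5.9 (pp. 40–41)] [cite: RaySprung2025, p. 2343]
[cite: Sprung2012, Thm. 2.2, Thm. 7.14 and Main Conj. 7.21] [cite: BCDTJAMS2001, Thm. A] -/
theorem sprungLowerHalfAtThree_of_sprungLowerDivisibility_of_namedFacts
    (hctrl : lem56AllN_sharpFlat_finite_coinvariants_of_finite_selmer)
    (hK : lem59AllN_sharpFlatCharValue_rankZero) (hmod : exists_isNewformOf)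
    (h22 : Sprung2012.thm22_exists_isHondaSystem)
    (h714 : Sprung2012.thm714_sharpFlatSelmerDual_finite_torsion)
    (hK1 : SprungLowerDivisibilityAtThree) : SprungLowerHalfAtThree :=
  sprungLowerHalfAtThree_of_sprungLowerDivisibility hctrl hK
    (sharpFlatPublishedInputsAtThree_of_namedFacts hmod h22 h714) hK1

end Summit.BirchSwinnertonDyer.BirchSwinnertonDyer.Theorems.SprungLowerHalfAtThreeSplit

end
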